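import Literature.Probability.RandomPlanarGeometry.WholePlaneLoewnerBackwardMaps
import Mathlib.Analysis.ODE.Gronwall
import HarnessLib

/-!
# Stability of the backward whole-plane Loewner flow in the driving function

Topic `Probability/RandomPlanarGeometry`; theorems only (no definition, no named fact). Sequel of
`WholePlaneLoewnerBackwardFlow` / `WholePlaneLoewnerBackwardMaps`. The backward trajectory
`orbit lam t w s` (`s ≤ t`, `|w| > 1`) of the whole-plane Loewner equation depends Lipschitz
continuously on the driving angle restricted to `[s, t]` and on the initial point (Grönwall's
inequality, Mathlib `dist_le_of_approx_trajectories_ODE_of_mem`, with the Lipschitz constant of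
the field off the unit circle, `lipschitzOnWith_field`, and its Lipschitz dependence on the driving
point). Together with the uniform rate `norm_exp_mul_orbit_sub_invMap_le` this is the analytic
input for the measurability of the whole-plane inverse maps `F_t = invMap lam t` — hence of the
SLE curve — in the driving function (Lawler (2005), §4.3; the measurability remark of
Rohde–Schramm (2005), §3).

* `norm_drivW_sub_drivW_le`, `norm_field_sub_field_le_of_driver` — `|V_{λ'}(s,z) - V_λ(s,z)| ≤
  (2 + 2(1 + 2|z|)/δ²) |λ'_s - λ_s|` for `|z| ≥ 1 + δ`;
* `norm_orbit_le` — the a priori bound `|orbit t w s| ≤ |w| e^{t-s} e^{M_w}`, uniform in `λ`;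
* `dist_orbit_orbit_le` — **Grönwall stability**: the distance of the trajectories of two
  continuous driving angles from two initial points at time `t - L` is at most
  `gronwallBound |w - w'| K (C ε) L`, `ε` a bound for `|λ - λ'|` on `[t - L, t]`.

## References

* G. F. Lawler, *Conformally Invariant Processes in the Plane*, AMS (2005), §4.3. [Lawler2005]
* S. Rohde, O. Schramm, *Basic properties of SLE*, Ann. of Math. 161 (2005), §3. [RohdeSchramm2005]
-/

noncomputable section

open Set Filter Topology Metric Complex
open scoped NNReal

namespace Literature.Probability.RandomPlanarGeometry

namespace WholePlaneLoewner.BackwardFlow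

variable {lam lam' : ℝ → ℝ}

/-- The driving points of two angles differ by at most the angles. [folklore] -/
theorem norm_drivW_sub_drivW_le (lam lam' : ℝ → ℝ) (s : ℝ) :
    ‖drivW lam' s - drivW lam s‖ ≤ |lam' s - lam s| := by
  rw [drivW_apply, drivW_apply]
  have h : Complex.exp (lam' s * I) - Complex.exp (lam s * I) =
      Complex.exp (lam s * I) * (Complex.exp (I * ((lam' s - lam s : ℝ) : ℂ)) - 1) := by
    rw [mul_sub, mul_one, ← Complex.exp_add]
    congr 2
    push_cast; ring
  rw [h, norm_mul, Complex.norm_exp_ofReal_mul_I, one_mul]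
  exact Real.norm_exp_I_mul_ofReal_sub_one_le.trans (by rw [Real.norm_eq_abs])

/-- **Lipschitz dependence of the whole-plane field on the driving angle**, off the unit circle:
`|V_{λ'}(s, z) - V_λ(s, z)| ≤ (2 + 2(1 + 2|z|)/δ²) |λ'_s - λ_s|` for `|z| ≥ 1 + δ` (partial fractions
`V = -z - 2W + 2W²/(W - z)`). [folklore] -/
theorem norm_field_sub_field_le_of_driver (lam lam' : ℝ → ℝ) (s : ℝ) {δ : ℝ} (hδ : 0 < δ) {z : ℂ}
    (hz : 1 + δ ≤ ‖z‖) :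
    ‖field lam' s z - field lam s z‖ ≤ (2 + 2 * (1 + 2 * ‖z‖) / δ ^ 2) * |lam' s - lam s| := by
  have hz1 : 1 < ‖z‖ := by linarith
  set W := drivW lam s with hW
  set W' := drivW lam' s with hW'
  have hW1 : ‖W‖ = 1 := norm_drivW lam s
  have hW'1 : ‖W'‖ = 1 := norm_drivW lam' s
  have hWz : W - z ≠ 0 := drivW_sub_ne_zero lam hz1
  have hW'z : W' - z ≠ 0 := drivW_sub_ne_zero lam' hz1
  have hdW : δ ≤ ‖W - z‖ := by linarith [norm_sub_one_le_norm_drivW_sub lam s z]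
  have hdW' : δ ≤ ‖W' - z‖ := by linarith [norm_sub_one_le_norm_drivW_sub lam' s z]
  rw [field_eq_partialFraction lam' hW'z, field_eq_partialFraction lam hWz]
  have hid : -z - 2 * W' + 2 * W' ^ 2 / (W' - z) - (-z - 2 * W + 2 * W ^ 2 / (W - z)) =
      (W' - W) * (-2 + 2 * (W' * W - z * (W' + W)) / ((W' - z) * (W - z))) := by
    field_simp
    ring
  rw [hid, norm_mul, mul_comm]
  have hcoef : ‖-2 + 2 * (W' * W - z * (W' + W)) / ((W' - z) * (W - z))‖ ≤ 2 + 2 * (1 + 2 * ‖z‖) / δ ^ 2 := by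
    calc ‖-2 + 2 * (W' * W - z * (W' + W)) / ((W' - z) * (W - z))‖
        ≤ ‖(-2 : ℂ)‖ + ‖2 * (W' * W - z * (W' + W)) / ((W' - z) * (W - z))‖ := norm_add_le _ _
      _ ≤ 2 + 2 * (1 + 2 * ‖z‖) / δ ^ 2 := by
          refine add_le_add (by simp) ?_
          rw [norm_div, norm_mul, norm_mul, Complex.norm_two]
          have hnum : ‖W' * W - z * (W' + W)‖ ≤ 1 + 2 * ‖z‖ := by
            calc ‖W' * W - z * (W' + W)‖ ≤ ‖W' * W‖ + ‖z * (W' + W)‖ := norm_sub_le _ _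
              _ ≤ 1 + ‖z‖ * 2 := by
                  rw [norm_mul, norm_mul, hW1, hW'1, one_mul]
                  refine add_le_add le_rfl (mul_le_mul_of_nonneg_left ?_ (norm_nonneg _))
                  calc ‖W' + W‖ ≤ ‖W'‖ + ‖W‖ := norm_add_le _ _
                    _ = 2 := by rw [hW1, hW'1]; norm_num
              _ = 1 + 2 * ‖z‖ := by ring
          have hden : δ ^ 2 ≤ ‖W' - z‖ * ‖W - z‖ := by
            rw [sq]; exact mul_le_mul hdW' hdW hδ.le (norm_nonneg _)
          rw [mul_div_assoc, mul_div_assoc]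
          exact mul_le_mul_of_nonneg_left
            (div_le_div₀ (by positivity : (0 : ℝ) ≤ 1 + 2 * ‖z‖) hnum (by positivity) hden) (by norm_num)
  exact mul_le_mul hcoef (norm_drivW_sub_drivW_le lam lam' s) (norm_nonneg _) (by positivity)

/-- **A priori bound of the backward trajectory, uniform in the driving angle**:
`|orbit t w s| ≤ |w| e^{t - s} e^{M_w}` for `s ≤ t` (`dist_zeta_le`). [folklore] -/
theorem norm_orbit_le (hlam : Continuous lam) {t : ℝ} {w : ℂ} (hw : 1 < ‖w‖) {s : ℝ} (hs : s ≤ t) :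
    ‖orbit lam t w s‖ ≤ ‖w‖ * Real.exp (t - s) * Real.exp (errConst w) := by
  have hd := dist_zeta_le hlam hw hs le_rfl
  rw [logOrbit_self hlam hw, Real.exp_neg] at hd
  have hd' : dist (Complex.log w + t) (logOrbit lam t w s + s) ≤ errConst w := by
    refine hd.trans ?_
    rw [sub_self, mul_zero, Real.exp_zero, inv_one, mul_one]
  have hre : (logOrbit lam t w s).re + s - (Real.log ‖w‖ + t) ≤ errConst w := by
    have h1 := Complex.abs_re_le_norm (logOrbit lam t w s + s - (Complex.log w + t))
    rw [← dist_eq_norm, dist_comm] at h1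
    have h2 : (logOrbit lam t w s + ↑s - (Complex.log w + ↑t)).re =
        (logOrbit lam t w s).re + s - (Real.log ‖w‖ + t) := by
      simp [Complex.log_re]
    rw [h2] at h1
    exact (le_abs_self _).trans (h1.trans hd')
  rw [norm_orbit, ← Real.exp_log (zero_lt_one.trans hw), ← Real.exp_add, ← Real.exp_add]
  exact Real.exp_le_exp.2 (by linarith)

/-- **Grönwall stability of the backward trajectories in the driving angle and the initial
point.** Let `λ, λ'` be continuous, `|w|, |w'| ≥ 1 + δ` (`δ > 0`), `L ≥ 0`, `|λ_s - λ'_s| ≤ ε` on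
`[t - L, t]`, and `B` an upper bound for `|w'| e^{L} e^{M_{w'}}`. Then
`dist (orbit λ t w (t - L)) (orbit λ' t w' (t - L)) ≤ gronwallBound (dist w w') (1 + 2/δ²)
((2 + 2(1 + 2B)/δ²) ε) L`. [cite: Lawler2005, §4.3] -/
theorem dist_orbit_orbit_le (hlam : Continuous lam) (hlam' : Continuous lam') {t L : ℝ} (hL : 0 ≤ L)
    {δ : ℝ≥0} (hδ : 0 < δ) {w w' : ℂ} (hw : 1 + (δ : ℝ) ≤ ‖w‖) (hw' : 1 + (δ : ℝ) ≤ ‖w'‖)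
    {B : ℝ} (hB : ‖w'‖ * Real.exp L * Real.exp (errConst w') ≤ B)
    {ε : ℝ} (hε : ∀ s ∈ Icc (t - L) t, |lam' s - lam s| ≤ ε) :
    dist (orbit lam t w (t - L)) (orbit lam' t w' (t - L)) ≤
      gronwallBound (dist w w') (1 + 2 / δ ^ 2) ((2 + 2 * (1 + 2 * B) / δ ^ 2) * ε) L := by
  have hδ' : (0 : ℝ) < δ := hδ
  have hw1 : 1 < ‖w‖ := by linarith
  have hw'1 : 1 < ‖w'‖ := by linarith
  -- reversed time
  set f : ℝ → ℂ := fun τ ↦ orbit lam t w (t - τ) with hf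
  set g : ℝ → ℂ := fun τ ↦ orbit lam' t w' (t - τ) with hg
  set v : ℝ → ℂ → ℂ := fun τ z ↦ -field lam (t - τ) z with hv
  have hfd : ∀ τ, 0 ≤ τ → HasDerivAt f (-field lam (t - τ) (f τ)) τ := fun τ hτ ↦
    HasDerivAt.comp_const_sub t τ (hasDerivAt_orbit hlam hw1 (show t - τ ≤ t by linarith))
  have hgd : ∀ τ, 0 ≤ τ → HasDerivAt g (-field lam' (t - τ) (g τ)) τ := fun τ hτ ↦
    HasDerivAt.comp_const_sub t τ (hasDerivAt_orbit hlam' hw'1 (show t - τ ≤ t by linarith))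
  have hεnn : 0 ≤ ε := (abs_nonneg _).trans (hε t ⟨by linarith, le_rfl⟩)
  have hBnn : 0 ≤ B := le_trans (by positivity) hB
  have key := dist_le_of_approx_trajectories_ODE_of_mem (v := v)
    (s := fun _ ↦ {z : ℂ | 1 + (δ : ℝ) ≤ ‖z‖}) (K := 1 + 2 / δ ^ 2)
    (f := f) (g := g) (f' := fun τ ↦ -field lam (t - τ) (f τ)) (g' := fun τ ↦ -field lam' (t - τ) (g τ))
    (a := 0) (b := L) (εf := 0) (εg := (2 + 2 * (1 + 2 * B) / δ ^ 2) * ε) (δ := dist w w')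
    (fun τ _ ↦ LipschitzOnWith.of_dist_le_mul fun x hx y hy ↦ by
      simp only [hv, dist_neg_neg]; exact (lipschitzOnWith_field lam (t - τ) hδ).dist_le_mul x hx y hy)
    (fun τ hτ ↦ (hfd τ hτ.1).continuousAt.continuousWithinAt)
    (fun τ hτ ↦ (hfd τ hτ.1).hasDerivWithinAt)
    (fun τ hτ ↦ by simp [hv])
    (fun τ hτ ↦ hw.trans (norm_le_norm_orbit hlam hw1 (by linarith [hτ.1])))
    (fun τ hτ ↦ (hgd τ hτ.1).continuousAt.continuousWithinAt)
    (fun τ hτ ↦ (hgd τ hτ.1).hasDerivWithinAt)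
    (fun τ hτ ↦ ?_)
    (fun τ hτ ↦ hw'.trans (norm_le_norm_orbit hlam' hw'1 (by linarith [hτ.1])))
    (by simp [hf, hg, orbit_self hlam hw1, orbit_self hlam' hw'1])
  · have := key L ⟨hL, le_rfl⟩
    simpa [hf, hg, zero_add] using this
  -- the perturbation bound along `g`
  simp only [hv, dist_eq_norm, neg_sub_neg]
  have hgz : 1 + (δ : ℝ) ≤ ‖g τ‖ := hw'.trans (norm_le_norm_orbit hlam' hw'1 (by linarith [hτ.1]))
  have hgB : ‖g τ‖ ≤ B := by
    refine (norm_orbit_le hlam' hw'1 (show t - τ ≤ t by linarith [hτ.1])).trans (le_trans ?_ hB)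
    have : Real.exp (t - (t - τ)) ≤ Real.exp L := Real.exp_le_exp.2 (by linarith [hτ.2])
    gcongr
  calc ‖field lam (t - τ) (g τ) - field lam' (t - τ) (g τ)‖
      = ‖field lam' (t - τ) (g τ) - field lam (t - τ) (g τ)‖ := norm_sub_rev _ _
    _ ≤ (2 + 2 * (1 + 2 * ‖g τ‖) / δ ^ 2) * |lam' (t - τ) - lam (t - τ)| :=
        norm_field_sub_field_le_of_driver lam lam' _ hδ' hgz
    _ ≤ (2 + 2 * (1 + 2 * B) / δ ^ 2) * ε := by
        refine mul_le_mul ?_ (hε _ ⟨by linarith [hτ.2], by linarith [hτ.1]⟩) (abs_nonneg _)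
          (by have : 0 ≤ 2 * (1 + 2 * B) / (δ : ℝ) ^ 2 := by positivity
              linarith)
        gcongr

end WholePlaneLoewner.BackwardFlow

end Literature.Probability.RandomPlanarGeometry
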